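import Mathlib
import Summits.ValiantsHypothesis.ValiantsHypothesis.Theorems.LacunarySymmetroidMatrixDescartesInertiaOneType
import Summits.ValiantsHypothesis.ValiantsHypothesis.Theorems.LacunarySymmetroidMatrixDescartesStubNegRoots
import Summits.ValiantsHypothesis.ValiantsHypothesis.Theorems.LacunarySymmetroidMatrixDescartesCensusFatSectors

/-!
# `MatrixDescartes` (stmt-ValiantsHypothesis-18050) — the TWO-SIDED ONE-TYPE SECTOR in the crux's currency: `Z ≤ 2m + 1`
# distinct real zeros, and the crux inequality at every fat format

HONEST FRAMING.  Cell `pub-symmetroid`, seat `val-sym-mdr-p2` (gen 17); helper LEAF file `--supports` the crux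
`Theses.LacunarySymmetroid.MatrixDescartes`, NO closure claim.  Like gen 14's `…DefiniteMomentsMDR`, gen 15's `…ZonesMDR` and gen 16's
`…OneCrossingMDR` it imports the census cone's `Census.fatFormat_absorb` (theses-cone warning: leaf file, nothing imports it).  A
new FORMAT-FREE family on which the crux inequality `Z^q ≤ 2^{K⌊log₂K⌋}` is PROVED at every admissible size, fat formats included;
nothing here bears on the crux in its window, on `stub_twoSided`, on `DoorA26`/`DoorA34`, registers, or `VP ≠ VNP`.

CONTENT.  (§1) `oneType_realRoots_le` — if every positive root of `det F(X)` is of one definite type (all negative type, or all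
positive type: every non-zero kernel vector's Rayleigh polynomial strictly decreasing, resp. increasing, through the root) and the
same holds for the reflected pencil `F(−X) = ∑ X^{dₗ}((−1)^{dₗ}Sₗ)`, then `det F` has at most `m + m + 1` distinct real zeros
(`Inertia.card_posRoots_le_of_negType/posType` on both half-lines + `stub_negRoots`).  (§2) `oneType_mdr` — hence
`Z^q ≤ 2^{K⌊log₂K⌋}` for all `K ≥ K₀(c, q)` and all `m ≤ 2^{(⌊log₂K⌋+c)^c}`. [folklore]; axioms standard; no definitions.
-/

-- layout Summits/ValiantsHypothesis/ValiantsHypothesis forces the duplicated namespace component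
set_option linter.dupNamespace false

namespace Summit.ValiantsHypothesis.ValiantsHypothesis.Theorems.LacunarySymmetroidMatrixDescartes

open Polynomial Matrix Finset
open scoped BigOperators Topology

namespace Inertia

/-! ## §1 Both half-lines -/

/-- **One-type law, either type (distinct positive roots `≤ m`).** [folklore] -/
theorem card_posRoots_le_of_oneType {K m : ℕ} (d : Fin K → ℕ) (S : Fin K → Matrix (Fin m) (Fin m) ℝ)
    (hS : ∀ l, (S l).IsSymm)
    (hone : (∀ t, 0 < t → (∑ k, t ^ d k • S k).det = 0 → ∀ u : Fin m → ℝ, (∑ k, t ^ d k • S k) *ᵥ u = 0 → u ≠ 0 →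
        (derivative (∑ k, C (u ⬝ᵥ (S k *ᵥ u)) * (X : ℝ[X]) ^ d k)).eval t < 0) ∨
      (∀ t, 0 < t → (∑ k, t ^ d k • S k).det = 0 → ∀ u : Fin m → ℝ, (∑ k, t ^ d k • S k) *ᵥ u = 0 → u ≠ 0 →
        0 < (derivative (∑ k, C (u ⬝ᵥ (S k *ᵥ u)) * (X : ℝ[X]) ^ d k)).eval t)) :
    ((Matrix.det (∑ k, ((X : ℝ[X]) ^ d k) • (S k).map C)).roots.toFinset.filter (fun t => 0 < t)).card ≤ m := by
  rcases hone with h | h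
  · have := card_posRoots_le_of_negType d S hS h
    rwa [Fintype.card_fin] at this
  · have := card_posRoots_le_of_posType d S hS h
    rwa [Fintype.card_fin] at this

/-- **Real zeros on the two-sided one-type sector.**  Real symmetric `m × m` letters; if the positive roots of `det F(X)` are all of
one definite type and those of the reflected pencil `F(−X) = ∑ X^{dₗ}((−1)^{dₗ}Sₗ)` are all of one definite type, then `det F` has at
most `m + m + 1` distinct real zeros. [folklore] -/
theorem oneType_realRoots_le (K m : ℕ) (d : Fin K → ℕ) (S : Fin K → Matrix (Fin m) (Fin m) ℝ) (hS : ∀ l, (S l).IsSymm)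
    (hone : (∀ t, 0 < t → (∑ k, t ^ d k • S k).det = 0 → ∀ u : Fin m → ℝ, (∑ k, t ^ d k • S k) *ᵥ u = 0 → u ≠ 0 →
        (derivative (∑ k, C (u ⬝ᵥ (S k *ᵥ u)) * (X : ℝ[X]) ^ d k)).eval t < 0) ∨
      (∀ t, 0 < t → (∑ k, t ^ d k • S k).det = 0 → ∀ u : Fin m → ℝ, (∑ k, t ^ d k • S k) *ᵥ u = 0 → u ≠ 0 →
        0 < (derivative (∑ k, C (u ⬝ᵥ (S k *ᵥ u)) * (X : ℝ[X]) ^ d k)).eval t))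
    (hone' : (∀ t, 0 < t → (∑ k, t ^ d k • (((-1 : ℝ) ^ d k) • S k)).det = 0 → ∀ u : Fin m → ℝ,
        (∑ k, t ^ d k • (((-1 : ℝ) ^ d k) • S k)) *ᵥ u = 0 → u ≠ 0 →
        (derivative (∑ k, C (u ⬝ᵥ ((((-1 : ℝ) ^ d k) • S k) *ᵥ u)) * (X : ℝ[X]) ^ d k)).eval t < 0) ∨
      (∀ t, 0 < t → (∑ k, t ^ d k • (((-1 : ℝ) ^ d k) • S k)).det = 0 → ∀ u : Fin m → ℝ,
        (∑ k, t ^ d k • (((-1 : ℝ) ^ d k) • S k)) *ᵥ u = 0 → u ≠ 0 →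
        0 < (derivative (∑ k, C (u ⬝ᵥ ((((-1 : ℝ) ^ d k) • S k) *ᵥ u)) * (X : ℝ[X]) ^ d k)).eval t)) :
    (Matrix.det (∑ l, ((X : ℝ[X]) ^ d l) • (S l).map C)).roots.toFinset.card ≤ m + m + 1 := by
  have h1 := card_posRoots_le_of_oneType d S hS hone
  have h2 := card_posRoots_le_of_oneType d (fun l => ((-1 : ℝ) ^ d l) • S l) (fun l => (hS l).smul _) hone'
  have h3 := stub_negRoots K m d S
  omega

/-! ## §2 The crux's inequality on the sector -/

/-- **The crux inequality on the two-sided one-type sector, every fat format.**  For all `c, q` there is `K₀` such that for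
`K ≥ K₀`, `m ≤ 2^{(⌊log₂K⌋+c)^c}`, all exponents and all real symmetric letters with `F(X)` and `F(−X)` both one-typed on their
positive roots: `Z^q ≤ 2^{K⌊log₂K⌋}`. [folklore] -/
theorem oneType_mdr (c q : ℕ) : ∃ K₀ : ℕ, ∀ K m : ℕ, K₀ ≤ K → m ≤ 2 ^ ((Nat.log 2 K + c) ^ c) →
    ∀ (d : Fin K → ℕ) (S : Fin K → Matrix (Fin m) (Fin m) ℝ), (∀ l, (S l).IsSymm) →
    ((∀ t, 0 < t → (∑ k, t ^ d k • S k).det = 0 → ∀ u : Fin m → ℝ, (∑ k, t ^ d k • S k) *ᵥ u = 0 → u ≠ 0 →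
        (derivative (∑ k, C (u ⬝ᵥ (S k *ᵥ u)) * (X : ℝ[X]) ^ d k)).eval t < 0) ∨
      (∀ t, 0 < t → (∑ k, t ^ d k • S k).det = 0 → ∀ u : Fin m → ℝ, (∑ k, t ^ d k • S k) *ᵥ u = 0 → u ≠ 0 →
        0 < (derivative (∑ k, C (u ⬝ᵥ (S k *ᵥ u)) * (X : ℝ[X]) ^ d k)).eval t)) →
    ((∀ t, 0 < t → (∑ k, t ^ d k • (((-1 : ℝ) ^ d k) • S k)).det = 0 → ∀ u : Fin m → ℝ,
        (∑ k, t ^ d k • (((-1 : ℝ) ^ d k) • S k)) *ᵥ u = 0 → u ≠ 0 →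
        (derivative (∑ k, C (u ⬝ᵥ ((((-1 : ℝ) ^ d k) • S k) *ᵥ u)) * (X : ℝ[X]) ^ d k)).eval t < 0) ∨
      (∀ t, 0 < t → (∑ k, t ^ d k • (((-1 : ℝ) ^ d k) • S k)).det = 0 → ∀ u : Fin m → ℝ,
        (∑ k, t ^ d k • (((-1 : ℝ) ^ d k) • S k)) *ᵥ u = 0 → u ≠ 0 →
        0 < (derivative (∑ k, C (u ⬝ᵥ ((((-1 : ℝ) ^ d k) • S k) *ᵥ u)) * (X : ℝ[X]) ^ d k)).eval t)) →
    (Matrix.det (∑ l, ((X : ℝ[X]) ^ d l) • (S l).map C)).roots.toFinset.card ^ q ≤ 2 ^ (K * Nat.log 2 K) := by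
  obtain ⟨K₀, hK₀⟩ := Census.fatFormat_absorb 1 c q
  refine ⟨K₀, fun K m hK hm d S hS hone hone' => hK₀ K m _ hK hm ?_⟩
  have hZ := oneType_realRoots_le K m d S hS hone hone'
  have h4 : m + m + 1 ≤ 2 ^ 1 * (m + 1) * (K + 1) := by nlinarith
  exact hZ.trans h4

end Inertia

end Summit.ValiantsHypothesis.ValiantsHypothesis.Theorems.LacunarySymmetroidMatrixDescartes
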